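import Summits.Parity.BatemanHorn.Theorems.RoughValueTransportDefs
import Literature.NumberTheory.Sieve.SieveFramework
import Summits.Parity.BatemanHorn.Theorems.BalancedSemiprimeLayer.Negative.NatDegreePos
import HarnessLib

/-!
# Route `RoughValueTransport`, crux `BalancedSemiprimeLayer` (stmt-Parity-9469), line
# `rough-relaxed-divisor-sieve` (companion lead c1): anchor C `stub_coordLayer_le_sifted`
# of the skeleton `Lines/rough_relaxed_divisor_sieve_c1.lean` — the injection

The elementary "relax both primes" step of the degree-blind lever of the line.  For a coordinate
`g = fᵢ` (degree `d ≥ 1`) of a Bateman–Horn system `f`, `0 < c < 3/8`, `0 < δ ≤ 1/4` and `x`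
large, the coordinate layer `E_{f,i}(x, δ) = coordLayer f i δ x` (the `1 ≤ n ≤ x` that are JOINTLY
rough to the crux's depth — every `fⱼ(n) > 0` and free of primes `< x^{deg fⱼ (1−δ)/2}` — whose
`i`-th value is not prime) satisfies

`coordLayer f i δ x ≤ d + ∑_{m ∈ W} #{n ∈ posRange f x : m ∣ g(n), (F(n), P) = 1}`

with `W = roughDivWindow d δ c x`, `F = ∏ⱼ fⱼ` and `P = P(x^c) = primesProdBelow (x^c)`, the
product of the primes `< x^c`.

Proof.  A layer point `n` has `g(n) = 1` — at most `d` of them, the integer roots of `g − 1` — or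
`v = g(n) ≥ 2` composite, so `p₁ := minFac v` is a prime with `p₁ ∣ v`, `p₁² ≤ v`.  Roughness of
`g(n)` gives `p₁ ≥ ⌈x^{d(1−δ)/2}⌉`; the size bound `v ≤ (∑ |coeff g|)(x+1)^d ≤ x^{dδ}·x^d`
(eventually) gives `p₁ ≤ x^{d(1+δ)/2}`; so `p₁ ∈ divWindow d δ x`, it is squarefree, and its only
prime factor `p₁ ≥ x^{d(1−δ)/2} ≥ x^{3/8} > x^c`: `p₁ ∈ roughDivWindow d δ c x`.  Moreover
`n ∈ posRange f x` and `F(n)` is coprime to `P(x^c)` because a prime `q < x^c ≤ x^{deg fⱼ (1−δ)/2}`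
dividing `F(n)` divides some `fⱼ(n)`, contradicting joint roughness.  Counting the second kind of
`n` fibrewise over `m = p₁ ∈ roughDivWindow` gives the sum.

References: the line card `Cruxes/BalancedSemiprimeLayer/Lines/rough-relaxed-divisor-sieve.md`
(lever S1, "relax both primes"); the degree-2 template is `stub_quadraticDictionary`
(`Theorems/RoughValueTransportBalancedSemiprimeLayerQuadraticDictionary.lean`).
-/

noncomputable section

open Polynomial Filter Finset
open Literature.NumberTheory.Sieve

namespace Summit.Parity.BatemanHorn.Cruxes.BalancedSemiprimeLayer.RoughRelaxedDivisorSieve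

open Summit.Parity.BatemanHorn.Cruxes.BalancedSemiprimeLayer.SmoothModulusTwistedHooley (coordLayer)
open Summit.Parity.BatemanHorn.Theorems.BalancedSemiprimeLayer.Negative
  (natDegree_pos_of_isBatemanHornSystem)

/-! ### Elementary inputs: roots of `g − 1`, size of the values -/

/-- At most `deg g` naturals `n` of any finset have `g(n) = 1` when `deg g ≥ 1`: they are roots of
`g − 1`, which has at most `deg g` roots (`Polynomial.card_roots_sub_C'`). [folklore] -/
private theorem card_filter_eval_eq_one_le {g : ℤ[X]} (hg : 0 < g.natDegree) (s : Finset ℕ) :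
    #(s.filter (fun n : ℕ => g.eval (n : ℤ) = 1)) ≤ g.natDegree := by
  have hdeg : 0 < g.degree := natDegree_pos_iff_degree_pos.mp hg
  calc #(s.filter (fun n : ℕ => g.eval (n : ℤ) = 1))
      ≤ #((g - C 1).roots.toFinset) := by
        refine Finset.card_le_card_of_injOn (fun n : ℕ => (n : ℤ)) ?_ ?_
        · intro n hn
          rw [Finset.mem_coe, Finset.mem_filter] at hn
          rw [Finset.mem_coe, Multiset.mem_toFinset, Polynomial.mem_roots_sub_C hdeg]
          exact hn.2
        · exact Nat.cast_injective.injOn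
    _ ≤ Multiset.card (g - C 1).roots := Multiset.toFinset_card_le _
    _ ≤ g.natDegree := Polynomial.card_roots_sub_C' hdeg

/-- `|g(n)| ≤ (∑_j |coeff_j g|)·(x+1)^{deg g}` for `0 ≤ n ≤ x`. [folklore] -/
private theorem natAbs_eval_le_coeffSum (g : ℤ[X]) {n x : ℕ} (hn : n ≤ x) :
    (g.eval (n : ℤ)).natAbs ≤
      (∑ j ∈ range (g.natDegree + 1), (g.coeff j).natAbs) * (x + 1) ^ g.natDegree := by
  rw [eval_eq_sum_range, sum_mul]
  refine (Int.natAbs_sum_le _ _).trans (sum_le_sum fun j hj => ?_)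
  rw [mem_range] at hj
  rw [Int.natAbs_mul, Int.natAbs_pow, Int.natAbs_natCast]
  refine Nat.mul_le_mul_left _ ?_
  calc n ^ j ≤ (x + 1) ^ j := Nat.pow_le_pow_left (by omega) _
    _ ≤ (x + 1) ^ g.natDegree := Nat.pow_le_pow_right (by omega) (by omega)

/-- `(g(n)).toNat ≤ (∑_j |coeff_j g|)·(x+1)^{deg g}` for `0 ≤ n ≤ x`. [folklore] -/
private theorem toNat_eval_le_coeffSum (g : ℤ[X]) {n x : ℕ} (hn : n ≤ x) :
    (g.eval (n : ℤ)).toNat ≤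
      (∑ j ∈ range (g.natDegree + 1), (g.coeff j).natAbs) * (x + 1) ^ g.natDegree :=
  le_trans (by omega) (natAbs_eval_le_coeffSum g hn)

/-! ### The injection, pointwise -/

/-- **Joint roughness ⇒ sifted.**  If `1 ≤ n ≤ x` is jointly rough to the crux's depth `δ ≤ 1/4`
(every `fⱼ(n) > 0` and free of primes `< x^{deg fⱼ (1−δ)/2}`) and `c < 3/8`, then `n ∈ posRange f x`
and `F(n) = ∏ⱼ fⱼ(n)` is coprime to `P(x^c)`: a prime `q < x^c` dividing `F(n)` divides some
`fⱼ(n)`, and `q < ⌈x^c⌉ ≤ ⌈x^{deg fⱼ (1−δ)/2}⌉` since `c < 3/8 ≤ deg fⱼ (1−δ)/2`. [folklore] -/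
theorem mem_posRange_and_coprime_of_rough {k : ℕ} {f : Fin k → ℤ[X]}
    (hf : IsBatemanHornSystem f) {δ c : ℝ} (hδ4 : δ ≤ 1 / 4) (hc : c < 3 / 8) {x n : ℕ}
    (hn : n ∈ Icc 1 x)
    (hrough : ∀ j, 0 < (f j).eval (n : ℤ) ∧
      ∀ p ∈ range ⌈(x : ℝ) ^ (((f j).natDegree : ℝ) * (1 - δ) / 2)⌉₊,
        p.Prime → ¬ ((p : ℤ) ∣ (f j).eval (n : ℤ))) :
    n ∈ posRange f x ∧
      ((∏ j, f j).eval (n : ℤ)).natAbs.Coprime (primesProdBelow ((x : ℝ) ^ c)) := by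
  refine ⟨mem_posRange.mpr ⟨hn, fun j => (hrough j).1⟩, ?_⟩
  rw [coprime_primesProdBelow_iff]
  intro q hq hqd
  rw [Nat.mem_primesBelow] at hq
  obtain ⟨hqlt, hqp⟩ := hq
  rw [Polynomial.eval_prod, ← Int.natCast_dvd] at hqd
  obtain ⟨j, -, hj⟩ := (Nat.prime_iff_prime_int.mp hqp).exists_mem_finset_dvd hqd
  refine (hrough j).2 q ?_ hqp hj
  rw [mem_range]
  refine lt_of_lt_of_le hqlt (Nat.ceil_mono ?_)
  have hx1 : (1 : ℝ) ≤ x := by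
    rw [mem_Icc] at hn
    exact_mod_cast hn.1.trans hn.2
  refine Real.rpow_le_rpow_of_exponent_le hx1 ?_
  have hd : (1 : ℝ) ≤ (f j).natDegree := by
    exact_mod_cast natDegree_pos_of_isBatemanHornSystem hf j
  nlinarith

/-- **The injection, pointwise.**  Let `g = fᵢ` (degree `d`) be a coordinate of a Bateman–Horn
system, `δ ≤ 1/4`, `c < 3/8`, and let `x ≥ 2` be so large that `(∑ |coeff g|)·2^d ≤ x^{dδ}`.  If
`1 ≤ n ≤ x` is jointly rough to the crux's depth, `g(n)` is not prime and `g(n) ≠ 1`, then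
`p₁ := minFac g(n)` lies in `roughDivWindow d δ c x` and divides `g(n)`: `p₁` is a prime divisor of
`v = g(n) ≥ 2` with `⌈x^{d(1−δ)/2}⌉ ≤ p₁` (roughness of `g(n)`),
`p₁² ≤ v ≤ (∑ |coeff g|)(x+1)^d ≤ x^{dδ}·x^d = (x^{d(1+δ)/2})²`, `p₁` is squarefree and its only
prime factor is `p₁ ≥ x^{d(1−δ)/2} > x^c` (`d ≥ 1`, `δ ≤ 1/4` give `d(1−δ)/2 ≥ 3/8 > c`).
[folklore] -/
theorem minFac_mem_roughDivWindow_of_coordLayer {k : ℕ} {f : Fin k → ℤ[X]}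
    (hf : IsBatemanHornSystem f) {i : Fin k} {δ c : ℝ} (hδ4 : δ ≤ 1 / 4) (hc : c < 3 / 8)
    {x : ℕ} (hx2 : 2 ≤ x)
    (hxH : ((∑ j ∈ range ((f i).natDegree + 1), ((f i).coeff j).natAbs : ℕ) : ℝ) *
        2 ^ (f i).natDegree ≤ (x : ℝ) ^ (((f i).natDegree : ℝ) * δ))
    {n : ℕ} (hn : n ∈ Icc 1 x)
    (hrough : ∀ j, 0 < (f j).eval (n : ℤ) ∧
      ∀ p ∈ range ⌈(x : ℝ) ^ (((f j).natDegree : ℝ) * (1 - δ) / 2)⌉₊,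
        p.Prime → ¬ ((p : ℤ) ∣ (f j).eval (n : ℤ)))
    (hnp : ¬ ((f i).eval (n : ℤ)).toNat.Prime) (h1 : (f i).eval (n : ℤ) ≠ 1) :
    ((f i).eval (n : ℤ)).toNat.minFac ∈ roughDivWindow (f i).natDegree δ c x ∧
      ((((f i).eval (n : ℤ)).toNat.minFac : ℕ) : ℤ) ∣ (f i).eval (n : ℤ) := by
  have hsize := toNat_eval_le_coeffSum (f i) (mem_Icc.mp hn).2
  set H := ∑ j ∈ range ((f i).natDegree + 1), ((f i).coeff j).natAbs with hH_def
  set d := (f i).natDegree with hd_def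
  have hd1 : 1 ≤ d := natDegree_pos_of_isBatemanHornSystem hf i
  rw [mem_Icc] at hn
  obtain ⟨hn1, hnx⟩ := hn
  have hx1 : (1 : ℝ) < x := by exact_mod_cast lt_of_lt_of_le one_lt_two hx2
  have hxpos : (0 : ℝ) < x := by linarith
  -- the value `v = g(n) ≥ 2` and its least prime factor `p₁`
  have hv_pos : 0 < (f i).eval (n : ℤ) := (hrough i).1
  have hm₀ : ((((f i).eval (n : ℤ)).toNat : ℕ) : ℤ) = (f i).eval (n : ℤ) :=
    Int.toNat_of_nonneg hv_pos.le
  have hv1 : ((f i).eval (n : ℤ)).toNat ≠ 1 := by omega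
  have hvpos : 0 < ((f i).eval (n : ℤ)).toNat := by omega
  set v := ((f i).eval (n : ℤ)).toNat with hv_def
  have hp₁ : v.minFac.Prime := Nat.minFac_prime hv1
  have hp₁sq : v.minFac ^ 2 ≤ v := Nat.minFac_sq_le_self hvpos hnp
  have hp₁v : ((v.minFac : ℕ) : ℤ) ∣ (f i).eval (n : ℤ) := by
    rw [← hm₀]
    exact Int.natCast_dvd_natCast.mpr (Nat.minFac_dvd _)
  -- lower bound: roughness of `g(n)` at level `x^{d(1-δ)/2}`
  have hceil : ⌈(x : ℝ) ^ ((d : ℝ) * (1 - δ) / 2)⌉₊ ≤ v.minFac := by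
    refine not_lt.mp fun hlt => (hrough i).2 _ ?_ hp₁ hp₁v
    rw [mem_range]
    exact hlt
  have hp₁ge : (x : ℝ) ^ ((d : ℝ) * (1 - δ) / 2) ≤ (v.minFac : ℝ) :=
    (Nat.le_ceil _).trans (by exact_mod_cast hceil)
  -- upper bound: `p₁² ≤ v ≤ H (x+1)^d ≤ H 2^d x^d ≤ x^{dδ} x^d = (x^{d(1+δ)/2})²`
  have hvle : ((v : ℕ) : ℝ) ≤ (x : ℝ) ^ ((d : ℝ) * (1 + δ)) := by
    have h2 : ((x : ℝ) + 1) ^ d ≤ 2 ^ d * (x : ℝ) ^ d := by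
      rw [← mul_pow]
      exact pow_le_pow_left₀ (by positivity) (by linarith) d
    calc ((v : ℕ) : ℝ) ≤ (H : ℝ) * ((x : ℝ) + 1) ^ d := by exact_mod_cast hsize
      _ ≤ (H : ℝ) * (2 ^ d * (x : ℝ) ^ d) := by gcongr
      _ = (H : ℝ) * 2 ^ d * (x : ℝ) ^ d := by ring
      _ ≤ (x : ℝ) ^ ((d : ℝ) * δ) * (x : ℝ) ^ d := by gcongr
      _ = (x : ℝ) ^ ((d : ℝ) * (1 + δ)) := by
          rw [← Real.rpow_natCast, ← Real.rpow_add hxpos]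
          congr 1
          ring
  have hp₁le : (v.minFac : ℝ) ≤ (x : ℝ) ^ ((d : ℝ) * (1 + δ) / 2) := by
    have h2 : (v.minFac : ℝ) ^ 2 ≤ ((x : ℝ) ^ ((d : ℝ) * (1 + δ) / 2)) ^ 2 := by
      calc (v.minFac : ℝ) ^ 2 ≤ ((v : ℕ) : ℝ) := by exact_mod_cast hp₁sq
        _ ≤ (x : ℝ) ^ ((d : ℝ) * (1 + δ)) := hvle
        _ = ((x : ℝ) ^ ((d : ℝ) * (1 + δ) / 2)) ^ 2 := by
            rw [← Real.rpow_mul_natCast hxpos.le]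
            congr 1
            push_cast
            ring
    exact (pow_le_pow_iff_left₀ (by positivity) (by positivity) two_ne_zero).mp h2
  -- the exponent comparison `c < 3/8 ≤ d(1-δ)/2`
  have hcd : c < (d : ℝ) * (1 - δ) / 2 := by
    have hd : (1 : ℝ) ≤ d := by exact_mod_cast hd1
    nlinarith
  have hxc : (x : ℝ) ^ c < (v.minFac : ℝ) :=
    (Real.rpow_lt_rpow_of_exponent_lt hx1 hcd).trans_le hp₁ge
  -- membership
  refine ⟨?_, hp₁v⟩
  rw [mem_roughDivWindow]
  refine ⟨?_, Irreducible.squarefree hp₁, ?_⟩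
  · unfold divWindow
    rw [mem_Icc]
    exact ⟨hceil, Nat.le_floor hp₁le⟩
  · intro p hp hpm
    rw [(Nat.prime_dvd_prime_iff_eq hp hp₁).mp hpm]
    exact hxc

/-! ### The injection, counted -/

/-- **Counting the composite layer points fibrewise.**  Under the hypotheses of
`minFac_mem_roughDivWindow_of_coordLayer` on `x`, the layer points `n` with `fᵢ(n) ≠ 1` are at
most `∑_{m ∈ roughDivWindow dᵢ δ c x} #{n ∈ posRange f x : m ∣ fᵢ(n), (F(n), P(x^c)) = 1}`:
sort them by `m = minFac fᵢ(n)`. [folklore] -/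
theorem card_coordLayer_ne_one_le_sum {k : ℕ} {f : Fin k → ℤ[X]}
    (hf : IsBatemanHornSystem f) {i : Fin k} {δ c : ℝ} (hδ4 : δ ≤ 1 / 4) (hc : c < 3 / 8)
    {x : ℕ} (hx2 : 2 ≤ x)
    (hxH : ((∑ j ∈ range ((f i).natDegree + 1), ((f i).coeff j).natAbs : ℕ) : ℝ) *
        2 ^ (f i).natDegree ≤ (x : ℝ) ^ (((f i).natDegree : ℝ) * δ)) :
    #(((Icc 1 x).filter (fun n : ℕ => (∀ j, 0 < (f j).eval (n : ℤ) ∧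
        ∀ p ∈ range ⌈(x : ℝ) ^ (((f j).natDegree : ℝ) * (1 - δ) / 2)⌉₊,
          p.Prime → ¬ ((p : ℤ) ∣ (f j).eval (n : ℤ))) ∧
        ¬ ((f i).eval (n : ℤ)).toNat.Prime)).filter (fun n : ℕ => ¬ (f i).eval (n : ℤ) = 1)) ≤
      ∑ m ∈ roughDivWindow (f i).natDegree δ c x,
        #((posRange f x).filter (fun n : ℕ => ((m : ℤ) ∣ (f i).eval (n : ℤ)) ∧
          ((∏ j, f j).eval (n : ℤ)).natAbs.Coprime (primesProdBelow ((x : ℝ) ^ c)))) := by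
  rw [Finset.card_eq_sum_card_fiberwise
    (f := fun n : ℕ => ((f i).eval (n : ℤ)).toNat.minFac)
    (t := roughDivWindow (f i).natDegree δ c x) ?maps]
  · refine sum_le_sum fun m _ => card_le_card fun n hn => ?_
    rw [mem_filter, mem_filter, mem_filter] at hn
    obtain ⟨⟨⟨hnI, hrough, hnp⟩, h1⟩, hm⟩ := hn
    obtain ⟨hpos, hcop⟩ := mem_posRange_and_coprime_of_rough hf hδ4 hc hnI hrough
    have hdvd := (minFac_mem_roughDivWindow_of_coordLayer hf hδ4 hc hx2 hxH hnI hrough hnp h1).2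
    rw [hm] at hdvd
    exact mem_filter.mpr ⟨hpos, hdvd, hcop⟩
  · intro n hn
    rw [Finset.mem_coe, mem_filter, mem_filter] at hn
    obtain ⟨⟨hnI, hrough, hnp⟩, h1⟩ := hn
    exact (minFac_mem_roughDivWindow_of_coordLayer hf hδ4 hc hx2 hxH hnI hrough hnp h1).1

/-! ### Anchor C -/

/-- **Anchor C `stub_coordLayer_le_sifted`** (registered stub of the skeleton
`Cruxes/BalancedSemiprimeLayer/Lines/rough_relaxed_divisor_sieve_c1.lean`) — the injection (relax
both primes): for `0 < c < 3/8`, `0 < δ ≤ 1/4`, eventually `E_{f,i}(x, δ) ≤ dᵢ + S`, where `S`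
counts the pairs `(m, n)`, `m ∈ roughDivWindow dᵢ δ c x`, `n ∈ posRange f x`, `m ∣ fᵢ(n)`,
`(F(n), P(x^c)) = 1`.  A layer `n` has `fᵢ(n) = 1` (at most `dᵢ` of them: roots of `fᵢ − 1`) or
`m := minFac fᵢ(n)` prime with `m² ≤ fᵢ(n) ≤ x^{dᵢ(1+δ)}` and `m ≥ ⌈x^{dᵢ(1−δ)/2}⌉ > x^c` (joint
roughness), and `F(n)` has no prime factor `< x^c ≤ x^{dⱼ(1−δ)/2}`.  "Eventually" = `x ≥ 2` and
`(∑ |coeff fᵢ|)·2^{dᵢ} ≤ x^{dᵢ δ}`. [folklore] -/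
theorem stub_coordLayer_le_sifted :
    ∀ (k : ℕ) (f : Fin k → ℤ[X]), IsBatemanHornSystem f → ∀ (i : Fin k) (c δ : ℝ),
      0 < c → c < 3 / 8 → 0 < δ → δ ≤ 1 / 4 → ∀ᶠ x : ℕ in atTop,
        (coordLayer f i δ x : ℝ) ≤ ((f i).natDegree : ℝ) +
          ∑ m ∈ roughDivWindow (f i).natDegree δ c x,
            (#((posRange f x).filter (fun n : ℕ => ((m : ℤ) ∣ (f i).eval (n : ℤ)) ∧
                ((∏ j, f j).eval (n : ℤ)).natAbs.Coprime (primesProdBelow ((x : ℝ) ^ c)))) : ℝ) := by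
  intro k f hf i c δ _hc0 hc hδ hδ4
  have hd1 : 1 ≤ (f i).natDegree := natDegree_pos_of_isBatemanHornSystem hf i
  have hexp : 0 < ((f i).natDegree : ℝ) * δ := mul_pos (by exact_mod_cast hd1) hδ
  have hH : ∀ᶠ x : ℕ in atTop,
      ((∑ j ∈ range ((f i).natDegree + 1), ((f i).coeff j).natAbs : ℕ) : ℝ) *
        2 ^ (f i).natDegree ≤ (x : ℝ) ^ (((f i).natDegree : ℝ) * δ) :=
    ((tendsto_rpow_atTop hexp).comp tendsto_natCast_atTop_atTop).eventually_ge_atTop _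
  filter_upwards [hH, eventually_ge_atTop 2] with x hxH hx2
  have hnat : coordLayer f i δ x ≤ (f i).natDegree +
      ∑ m ∈ roughDivWindow (f i).natDegree δ c x,
        #((posRange f x).filter (fun n : ℕ => ((m : ℤ) ∣ (f i).eval (n : ℤ)) ∧
          ((∏ j, f j).eval (n : ℤ)).natAbs.Coprime (primesProdBelow ((x : ℝ) ^ c)))) := by
    unfold coordLayer
    rw [← Finset.card_filter_add_card_filter_not (fun n : ℕ => (f i).eval (n : ℤ) = 1)]
    exact add_le_add (card_filter_eval_eq_one_le hd1 _)
      (card_coordLayer_ne_one_le_sum hf hδ4 hc hx2 hxH)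
  exact_mod_cast hnat

end Summit.Parity.BatemanHorn.Cruxes.BalancedSemiprimeLayer.RoughRelaxedDivisorSieve
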